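import Literature.AlgebraicGeometry.Frobenioids.ArchimedeanFSMFFCounterexample
import Literature.AlgebraicGeometry.Frobenioids.ArchimedeanFSMCounterexampleR
import Literature.AlgebraicGeometry.Frobenioids.ArchimedeanFSMOverIsoProofs
import Literature.AlgebraicGeometry.Frobenioids.FSMIMorphisms
import HarnessLib

/-!
# Frobenioids II, Proposition 3.4 (viii) fails for `F = R` over `D = D₀` as well
# (abc-iut cell, layer L1, node `FrdII:Prop3.4(viii)`, chain LC-L1-2 — the `R`-conjunct of the typed item)

Mochizuki, *The geometry of Frobenioids II: poly-Frobenioids*, Kyushu J. Math. **62** (2008)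
401–460, §3, Proposition 3.4 (viii) p. 30 — stated for EACH `F ∈ {A, N, R}`: "Suppose that `D` is
complexifiable, RC-connected, and of FSMFF-type. Then `F` is … of FSMFF-type."
[cite: MochizukiFrdII2008, Prop 3.4 (viii) p.30]

PROOF-ONLY file (nothing is defined). `ArchimedeanFSMFFCounterexample.lean` (abc-iut-L1-d3) refutes the
typed item at `π = 𝟭 D₀` through the tower `F = N`; this companion does the same for the RIGIDIFIED
angloid `F = R = R₀ ×_{D₀} D₀` (`towerR_id_not_propVIII`). Route: (1) `R` over `D₀` has NO FSMI-morphism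
from a complex object to a real object (`R.not_isFSMI_complex_real_id`) — a non-isotropic domain makes
the arrow factor through its naive isotropic hull (rigidified through the codomain) with two
non-invertible linear isometric factors, so it is not irreducible; for an isotropic domain with
rigidification `h_P`, the automorphism `(conj, 1, c · conj(c)⁻¹)` (`c` the scalar of the arrow) is
COMPATIBLE with `h_P` — because `h_P = φ ≫ h_Q` and the scalar of `h_Q` (an arrow out of a real object)
is real — and has the same composite with the arrow as the identity, so the arrow is not a monomorphism;
(2) FSMI-chains out of complex objects end at complex objects; (3) `R` over `D₀` HAS a non-invertible
FSM-morphism from a complex to a real object, read off abc-iut-L1-d3's refutation of (iii) for `R`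
(`towerR_id_not_propIII`). `D₀` satisfies the typed hypotheses (`ArchimedeanBaseRC`, abc-iut-L1-t4).
Only clause (a) of FSMFF-type is used. The repaired reading (complex regime) is `prop34_viii_of_isComplex`
(abc-iut-w5-d152). No side is taken on [IUTchIII] Cor. 3.12.
-/

namespace Literature.AlgebraicGeometry.Frobenioids

open CategoryTheory Set
open scoped Pointwise

noncomputable section

namespace ArchFrd

/-- In `R` over `D₀` there is no FSMI-morphism from a complex object to a real object.
[cite: MochizukiFrdII2008, Prop 3.4 (viii) p.33] -/
theorem R.not_isFSMI_complex_real_id {RP : AngularRegion ℂ}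
    (hRP : D0.complex = D0.real → RP.IsIsotropic)
    (hP : (⟨⟨C0.mk D0.complex RP hRP⟩⟩ : N0) ⟶ N0.realUnit) {PD : D0}
    (ιP : R0.toD0.obj (Over.mk hP) ≅ (𝟭 D0).obj PD)
    {RQ : AngularRegion ℂ} (hRQ : D0.real = D0.real → RQ.IsIsotropic)
    (hQ : (⟨⟨C0.mk D0.real RQ hRQ⟩⟩ : N0) ⟶ N0.realUnit) {QD : D0}
    (ιQ : R0.toD0.obj (Over.mk hQ) ≅ (𝟭 D0).obj QD)
    (φ : (⟨Over.mk hP, PD, ιP⟩ : R (𝟭 D0)) ⟶ ⟨Over.mk hQ, QD, ιQ⟩) : ¬ IsFSMI φ := by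
  intro hφ
  set φN := φ.fst.left with hφNdef
  set φ0 : C0.mk D0.complex RP hRP ⟶ C0.mk D0.real RQ hRQ := N0.homCarrier φN with hφ0def
  set hP0 : C0.mk D0.complex RP hRP ⟶ C0.realOfTip 1 := N0.homCarrier hP with hhP0
  set hQ0 : C0.mk D0.real RQ hRQ ⟶ C0.realOfTip 1 := N0.homCarrier hQ with hhQ0
  have hd : C0.degFr φ0 = 1 := φN.property
  have hdQ : C0.degFr hQ0 = 1 := hQ.property
  have hdP : C0.degFr hP0 = 1 := hP.property
  have hI : PreFrobenioid.IsIsometry C0.toElem φ0 := φN.hom.property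
  have hφt : ‖((C0.scalar φ0 : ℂˣ) : ℂ)‖ * (RP.tip : ℝ) = (RQ.tip : ℝ) := by
    have := (A0.isIsometry_iff_norm_mul_tip_pow φ0).mp hI
    rw [hd, PNat.one_coe, pow_one] at this
    exact this
  -- the rigidifications: `φ ≫ h_Q = h_P`, so `scalar h_P = scalar h_Q · scalar φ` with `scalar h_Q` real
  have hw0 : φ0 ≫ hQ0 = hP0 := by
    have := Over.w φ.fst
    exact congrArg N0.homCarrier this
  have hcP : C0.scalar hP0 = C0.scalar hQ0 * C0.scalar φ0 := by
    have := congrArg C0.scalar hw0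
    rw [C0.scalar_comp', hdQ, PNat.one_coe, pow_one] at this
    rw [← this]
    show D0.galAct (D0.Hom.twists (C0.Base φ0)) (C0.scalar hQ0) * C0.scalar φ0 = _
    rw [D0.twists_of_real, D0.galAct_false]
  have hQreal : D0.galAct true (C0.scalar hQ0) = C0.scalar hQ0 :=
    D0.galAct_eq_self_of_mem_scalars_real true hQ0.scalar_mem
  by_cases hisoP : RP.IsIsotropic
  · -- the automorphism `(conj, 1, c · conj(c)⁻¹)` of `P`, compatible with `h_P`, kills monomorphy
    set c : ℂˣ := C0.scalar φ0 with hc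
    have hw : absHom ℂ (c * (D0.galAct true c)⁻¹) = 1 := by
      rw [map_mul, map_inv, C0.absHom_galAct, mul_inv_cancel]
    have hmb : (c * (D0.galAct true c)⁻¹) • (C0.mk D0.complex RP hRP).region.carrier ^ ((1 : ℕ+) : ℕ) ⊆
        C0.pullRegion (C0.mk D0.complex RP hRP) D0.conj := by
      rw [PNat.one_coe, pow_one]
      rintro _ ⟨u, hu, rfl⟩
      show (c * (D0.galAct true c)⁻¹) • u ∈ D0.conj.act '' RP.carrier
      unfold D0.Hom.act
      rw [D0.twists_conj, C0.image_galAct_of_isIsotropic hisoP, C0.mem_carrier_of_isIsotropic hisoP,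
        smul_eq_mul, map_mul, hw, one_mul]
      exact hu.2
    have hmem : c * (D0.galAct true c)⁻¹ ∈ D0.scalars (C0.mk D0.complex RP hRP).base := by
      show _ ∈ D0.scalars D0.complex
      rw [D0.scalars_complex]
      exact Subgroup.mem_top _
    let b0 : C0.mk D0.complex RP hRP ⟶ C0.mk D0.complex RP hRP := ⟨D0.conj, 1, _, hmem, hmb⟩
    have hb0I : PreFrobenioid.IsIsometry C0.toElem b0 := by
      rw [A0.isIsometry_iff_norm_mul_tip_pow]
      show ‖((c * (D0.galAct true c)⁻¹ : ℂˣ) : ℂ)‖ * (RP.tip : ℝ) ^ ((1 : ℕ+) : ℕ) = (RP.tip : ℝ)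
      rw [← coe_absHom, hw, Positive.val_one, one_mul, PNat.one_coe, pow_one]
    let bN : (⟨⟨C0.mk D0.complex RP hRP⟩⟩ : N0) ⟶ ⟨⟨C0.mk D0.complex RP hRP⟩⟩ := N0.homMk b0 hb0I rfl
    -- compatibility with the rigidification of `P`
    have hbP : bN ≫ hP = hP := by
      apply N0.hom_ext
      rw [N0.homCarrier_comp]
      show b0 ≫ hP0 = hP0
      refine C0.hom_ext (D0.hom_to_real_eq rfl _ _) ?_ ?_
      · rw [C0.degFr_comp']
        exact one_mul _
      · rw [C0.scalar_comp', hdP, PNat.one_coe, pow_one]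
        show D0.galAct (D0.Hom.twists D0.conj) (C0.scalar hP0) * (c * (D0.galAct true c)⁻¹) = C0.scalar hP0
        rw [D0.twists_conj, hcP, map_mul, hQreal, mul_assoc, mul_left_comm (D0.galAct true c),
          mul_inv_cancel, mul_one]
    let bO : Over.mk hP ⟶ Over.mk hP := Over.homMk bN hbP
    have sq : R0.toD0.map bO ≫ ιP.hom = ιP.hom ≫ (𝟭 D0).map (ιP.inv ≫ D0.conj ≫ ιP.hom) := by
      show D0.conj ≫ ιP.hom = ιP.hom ≫ (ιP.inv ≫ D0.conj ≫ ιP.hom)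
      exact (ιP.hom_inv_id_assoc _).symm
    let PR : R (𝟭 D0) := ⟨Over.mk hP, PD, ιP⟩
    let b : PR ⟶ PR := ⟨bO, ιP.inv ≫ D0.conj ≫ ιP.hom, sq⟩
    have heq : b ≫ φ = 𝟙 _ ≫ φ := by
      rw [Category.id_comp]
      refine CFP.hom_ext (Over.OverMorphism.ext (N0.hom_ext ?_)) ?_
      · show N0.homCarrier (bN ≫ φN) = φ0
        rw [N0.homCarrier_comp]
        show b0 ≫ φ0 = φ0
        refine C0.hom_ext (D0.hom_to_real_eq rfl _ _) ?_ ?_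
        · rw [C0.degFr_comp']
          exact one_mul _
        · rw [C0.scalar_comp', hd, PNat.one_coe, pow_one]
          show D0.galAct (D0.Hom.twists D0.conj) c * (c * (D0.galAct true c)⁻¹) = c
          rw [D0.twists_conj, mul_left_comm, mul_inv_cancel, mul_one]
      · show (ιP.inv ≫ D0.conj ≫ ιP.hom) ≫ φ.snd = φ.snd
        exact (cancel_mono ιQ.inv).mp (D0.hom_to_real_eq rfl _ _)
    haveI := hφ.1.2
    have hb1 := (cancel_mono φ).mp heq
    have hbase := congrArg (fun f => C0.Base (N0.homCarrier f.fst.left)) hb1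
    exact D0.conj_ne_id hbase
  · -- factor through the naive isotropic hull (rigidified through `Q`): neither factor is an isomorphism
    let RP' : AngularRegion ℂ := AngularRegion.isotropicOfTip RP.tip
    have hRP' : D0.complex = D0.real → RP'.IsIsotropic := fun h => nomatch h
    have hisoP' : RP'.IsIsotropic := AngularRegion.isIsotropic_isotropicOfTip _
    have hmβ : (1 : ℂˣ) • (C0.mk D0.complex RP hRP).region.carrier ^ ((1 : ℕ+) : ℕ) ⊆
        C0.pullRegion (C0.mk D0.complex RP' hRP') (𝟙 D0.complex) := by
      rw [one_smul, PNat.one_coe, pow_one, C0.pullRegion_id]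
      intro u hu
      rw [C0.mem_carrier_of_isIsotropic hisoP']
      exact hu.2
    let β0 : C0.mk D0.complex RP hRP ⟶ C0.mk D0.complex RP' hRP' := ⟨𝟙 D0.complex, 1, 1, one_mem _, hmβ⟩
    have hβI : PreFrobenioid.IsIsometry C0.toElem β0 := by
      rw [A0.isIsometry_iff_norm_mul_tip_pow]
      show ‖((1 : ℂˣ) : ℂ)‖ * (RP.tip : ℝ) ^ ((1 : ℕ+) : ℕ) = (RP.tip : ℝ)
      rw [Units.val_one, norm_one, one_mul, PNat.one_coe, pow_one]
    have hmα : C0.scalar φ0 • (C0.mk D0.complex RP' hRP').region.carrier ^ ((1 : ℕ+) : ℕ) ⊆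
        C0.pullRegion (C0.mk D0.real RQ hRQ) (C0.Base φ0) := by
      rw [PNat.one_coe, pow_one]
      rintro _ ⟨u, hu, rfl⟩
      show C0.scalar φ0 • u ∈ (C0.Base φ0).act '' RQ.carrier
      unfold D0.Hom.act
      rw [D0.twists_of_real, D0.image_galAct_false, C0.mem_carrier_of_isIsotropic (hRQ rfl),
        absHom_le_iff, smul_eq_mul, Units.val_mul, norm_mul, ← hφt]
      have hu' : ‖(u : ℂ)‖ ≤ (RP.tip : ℝ) :=
        (absHom_le_iff u RP.tip).mp ((C0.mem_carrier_of_isIsotropic hisoP' u).mp hu)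
      exact mul_le_mul_of_nonneg_left hu' (norm_nonneg _)
    let α0 : C0.mk D0.complex RP' hRP' ⟶ C0.mk D0.real RQ hRQ :=
      ⟨(C0.Base φ0 :), 1, C0.scalar φ0, φ0.scalar_mem, hmα⟩
    have hαI : PreFrobenioid.IsIsometry C0.toElem α0 := by
      rw [A0.isIsometry_iff_norm_mul_tip_pow]
      show ‖((C0.scalar φ0 : ℂˣ) : ℂ)‖ * (RP.tip : ℝ) ^ ((1 : ℕ+) : ℕ) = (RQ.tip : ℝ)
      rw [PNat.one_coe, pow_one, hφt]
    have hβα : β0 ≫ α0 = φ0 := by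
      refine C0.hom_ext (D0.hom_to_real_eq rfl _ _) ?_ ?_
      · rw [C0.degFr_comp', hd]
        rfl
      · rw [C0.scalar_comp']
        show D0.galAct (D0.Hom.twists (𝟙 D0.complex)) (C0.scalar φ0) * 1 ^ ((1 : ℕ+) : ℕ) = C0.scalar φ0
        rw [D0.twists_id, D0.galAct_false, one_pow, mul_one]
    -- in `N₀` and `R₀`
    let PN : N0 := ⟨⟨C0.mk D0.complex RP hRP⟩⟩
    let P'N : N0 := ⟨⟨C0.mk D0.complex RP' hRP'⟩⟩
    let QN : N0 := ⟨⟨C0.mk D0.real RQ hRQ⟩⟩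
    let βN : PN ⟶ P'N := N0.homMk β0 hβI rfl
    let αN : P'N ⟶ QN := N0.homMk α0 hαI rfl
    have hβαN : βN ≫ αN = φN := N0.hom_ext hβα
    let P'O : R0 := Over.mk (αN ≫ hQ)
    let αO : P'O ⟶ Over.mk hQ := Over.homMk αN rfl
    have hβw : βN ≫ (αN ≫ hQ) = hP := by
      rw [← Category.assoc, hβαN]
      exact Over.w φ.fst
    let βO : Over.mk hP ⟶ P'O := Over.homMk βN hβw
    -- in `R`
    let PR : R (𝟭 D0) := ⟨Over.mk hP, PD, ιP⟩
    let P'R : R (𝟭 D0) := ⟨P'O, PD, ιP⟩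
    let QR : R (𝟭 D0) := ⟨Over.mk hQ, QD, ιQ⟩
    have sqβ : R0.toD0.map βO ≫ ιP.hom = ιP.hom ≫ (𝟭 D0).map (𝟙 PD) := by
      show 𝟙 D0.complex ≫ ιP.hom = ιP.hom ≫ 𝟙 PD
      exact (Category.id_comp _).trans (Category.comp_id _).symm
    let β : PR ⟶ P'R := ⟨βO, 𝟙 PD, sqβ⟩
    have wα : R0.toD0.map αO ≫ ιQ.hom = ιP.hom ≫ (𝟭 D0).map φ.snd := φ.w
    let α : P'R ⟶ QR := ⟨αO, φ.snd, wα⟩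
    have hfac : β ≫ α = φ := by
      refine CFP.hom_ext (Over.OverMorphism.ext ?_) (Category.id_comp _)
      show βN ≫ αN = φN
      exact hβαN
    rcases hφ.2.2 β α hfac with hα | hβ
    · haveI := hα
      exact (D0.isEmpty_hom_real_complex.false (C0.Base (N0.homCarrier (inv α).fst.left))).elim
    · haveI := hβ
      exact hisoP (C0.dir_eq_univ_of_hom (N0.homCarrier (inv β).fst.left) rfl)

/-- A single FSMI step of `R` over `D₀` out of a complex object ends at a complex object.
[cite: MochizukiFrdII2008, Prop 3.4 (viii) p.33] -/
theorem R.base_complex_of_isFSMI_id {P Q : R (𝟭 D0)} (φ : P ⟶ Q) (hφ : IsFSMI φ)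
    (hPc : R0.toD0.obj P.fst = D0.complex) : R0.toD0.obj Q.fst = D0.complex := by
  obtain ⟨⟨⟨⟨⟨KP, RP, hRP⟩⟩⟩, ⟨⟨⟩⟩, hP⟩, PD, ιP⟩ := P
  obtain ⟨⟨⟨⟨⟨KQ, RQ, hRQ⟩⟩⟩, ⟨⟨⟩⟩, hQ⟩, QD, ιQ⟩ := Q
  change KP = D0.complex at hPc
  subst hPc
  cases KQ with
  | complex => rfl
  | real => exact (R.not_isFSMI_complex_real_id hRP hP ιP hRQ hQ ιQ φ hφ).elim

/-- Every finite chain of FSMI-morphisms of `R` over `D₀` starting at a complex object ends at a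
complex object. [cite: MochizukiFrdII2008, Prop 3.4 (viii) p.33] -/
theorem R.base_complex_of_isFSMIChain_id {P Q : R (𝟭 D0)} {φ : P ⟶ Q} {n : ℕ}
    (h : IsFSMIChain φ n) : R0.toD0.obj P.fst = D0.complex → R0.toD0.obj Q.fst = D0.complex := by
  induction h with
  | single φ hφ => exact fun hP => R.base_complex_of_isFSMI_id φ hφ hP
  | cons ψ χ n hψ _ ih => exact fun hP => ih (R.base_complex_of_isFSMI_id ψ hψ hP)

/-- `R` over `D₀` has an FSM-morphism from a complex object to a real object — read off the refutation
of item (iii) for `R` (`towerR_id_not_propIII`). [cite: MochizukiFrdII2008, Prop 3.4 (iii) p.30] -/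
theorem R.exists_isFSM_complex_real_id :
    ∃ (P Q : R (𝟭 D0)) (φ : P ⟶ Q), IsFSM φ ∧ R0.toD0.obj P.fst = D0.complex ∧
      R0.toD0.obj Q.fst = D0.real := by
  by_contra h
  push Not at h
  refine towerR_id_not_propIII (fun P Q φ hφ => ?_)
  change IsFSM φ.snd
  rcases D0.isIso_or_eq φ.snd with hi | ⟨hP, hQ⟩
  · haveI := hi
    exact IsFSM.of_isIso _
  · have hPc : R0.toD0.obj P.fst = D0.complex := by
      rcases D0.isReal_or_isComplex (R0.toD0.obj P.fst) with hr | hc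
      · exact (D0.isEmpty_hom_real_complex.false (eqToHom hr.symm ≫ P.iso.hom ≫ eqToHom hP)).elim
      · exact hc
    have hQr : R0.toD0.obj Q.fst = D0.real := by
      rcases D0.isReal_or_isComplex (R0.toD0.obj Q.fst) with hr | hc
      · exact hr
      · exact (D0.isEmpty_hom_real_complex.false (eqToHom hQ.symm ≫ Q.iso.inv ≫ eqToHom hc)).elim
    exact (h P Q φ hφ hPc hQr).elim

/-- **`R` over `D₀` is NOT of FSMFF-type**: the complex → real FSM-morphism of
`R.exists_isFSM_complex_real_id` is not invertible and admits no factorization into FSMI-morphisms.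
[cite: MochizukiFrdII2008, Prop 3.4 (viii) p.30] -/
theorem R_id_not_isOfFSMFFType : ¬ IsOfFSMFFType (R (𝟭 D0)) := by
  intro h
  obtain ⟨P, Q, φ, hFSM, hP, hQ⟩ := R.exists_isFSM_complex_real_id
  have hnotIso : ¬ IsIso φ := by
    intro hi
    exact D0.isEmpty_hom_real_complex.false
      (eqToHom hQ.symm ≫ C0.Base (N0.homCarrier (inv φ).fst.left) ≫ eqToHom hP)
  obtain ⟨n, hchain⟩ := h.factors φ hFSM hnotIso
  have := R.base_complex_of_isFSMIChain_id hchain hP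
  rw [hQ] at this
  exact nomatch this

/-- **Prop. 3.4 (viii) fails for `F = R` over `D = D₀`** (`D₀` is complexifiable, RC-connected and of
FSMFF-type — `ArchimedeanBaseRC` — but the rigidified angloid `R` over it is not of FSMFF-type).
[cite: MochizukiFrdII2008, Prop 3.4 (viii) p.30] -/
theorem towerR_id_not_propVIII : ¬ (towerR (𝟭 D0)).PropVIII :=
  fun h => R_id_not_isOfFSMFFType
    (h D0.rc_isComplexifiable_id_comp D0.rc_isRCConnected_id_comp D0.isOfFSMFFType).2.2.2

end ArchFrd

end

end Literature.AlgebraicGeometry.Frobenioids
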